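import Summits.BirchSwinnertonDyer.Rank1Residual.GaloisImage.BigImTorsionLevels
import Literature.NumberTheory.EllipticCurves.NonEisensteinPrimeOfSurjective
import Literature.NumberTheory.EllipticCurves.WeilPairingProofs
import HarnessLib

/-!
# Sakamoto 2024 / Mazur–Rubin standing hypotheses (H.1), (H.2), (H.SD) for `(E[p^m], ℤ/p^m)` from
# `p`-adic (tower) surjectivity — the Stage-1 package of T-a3-F1 (cell `b2b-bsdres`, team n1011,
# seat p13; referee 1 RULING T-a3-F1 2026-08-21T05:51Z, option O1)

HONEST FRAMING (cell `b2b-bsdres`, run/shared/lean/b2b/bsd-rank1-residual/, verbatim in every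
file): the goal of the cell is to DELETE the COMBINATION-SHAPED residual classes of the
Birch–Swinnerton-Dyer formula for ALL analytic-rank `≤ 1` elliptic curves over `ℚ` — "full BSD
formula for every rank `≤ 1` curve in class `C`" assembled STRICTLY from published theorems — so
that the rank-`≤ 1` remainder becomes exactly the CONSTRUCTION-SHAPED classes, which are TYPED
(missing-input `Prop`s), NOT attempted. This is not "finishing BSD". Team n1011: prove what is
provable now; no claim beyond stated classes. Theorems only (no definition, no named fact; the
Weil pairing enters as the tree's PROVED `exists_weilPairing_holds`); nothing booked.

## What and why

R. Sakamoto, *The theory of Kolyvagin systems for `p = 3`*, JTNB 36 (2024) 919–946, §2 (p. 921)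
— the published `p = 3` Kolyvagin-system theory behind Kim 2025's announced `p = 3` case of the N11
statement — assumes, for a free module `T` over a zero-dimensional Gorenstein local ring `R`
(`3^α R = 0`, residue field `𝔽`) with `G_K`-action, `T̄ = T ⊗ 𝔽`:
(H.1) `T̄` is an irreducible `𝔽[G_K]`-module; (H.2) there is `τ ∈ G_{K(μ_{3^α})}` with
`T/(τ − 1)T ≅ R`; (H.3) `H¹(K(μ_{3^α})(T)/K, T̄) = 0`; (H.SD) `T̄ ≅ T̄^∨(1)` as `𝔽[G_K]`-modules.
Its Thm. 4.4 itself needs Kolyvagin-system vocabulary the tree does not have (T-a3-F1 Stage 2, a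
chartered typer session). This file is Stage 1: for the N11 instance `K = ℚ`, `R = ℤ/p^m`,
`T = E[p^m]` (`T̄ = E[p]`), the hypotheses (H.1), (H.2), (H.SD) HOLD under the team's binder (T)
"`ρ̄_{E,p^n}` onto for every `n`" (`= Kato2004.ImageContainsSL2`), in the tree's own vocabulary:

* (H.1) `W.HasIrreducibleModPGaloisRep p` — from surj(p) (`hasIrreducibleModPGaloisRep_of_hasSurjectiveModNGaloisRep`);
* (H.2) for EVERY level `m`, ONE `σ` fixing all `p`-power roots of unity with
  `E[p^m]/(σ − 1)E[p^m] ≃+ ℤ/p^m` (`exists_torsion_quotient_equiv_zmod_of_towerSurj`, sibling file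
  `BigImTorsionLevels`);
* (H.SD) in its source form: a bilinear, alternating, non-degenerate, `Γ_ℚ`-EQUIVARIANT pairing
  `E[p] × E[p] → μ_p ⊂ ℚ̄` (the Weil pairing, tree theorem `exists_weilPairing_holds`,
  Silverman *AEC* III.8.1) — which is the isomorphism `E[p] ≅ E[p]^∨(1) = Hom(E[p], μ_p)`;
* (H.3) is NOT restated here: its kernel form at `3` ("`−1 ∈` image ⟹ every crossed homomorphism
  `Gal(ℚ(μ_{3^α}, E[3^m])/ℚ) → E[3]` is principal", Sah's lemma) lives in x11b3-p7's
  `X11b/Three/ImageSah(Tower).lean` and p15's `Additive/KimThreeSahLemma.lean` (lead R3-20: one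
  consumer, no fourth file).

`sakamotoHypotheses_of_towerSurj` packages (H.1) ∧ (H.2)_{all m} ∧ (H.SD) under (T) for any prime
`p` (at `p = 3`: `sakamotoHypotheses_three_of_towerSurj`, `…_of_surj_nine`). These are T-a3's
ledger rows S1 (skel/T-a3.md v2 §3) as kernel theorems; they type NO part of Thm. 4.4's conclusion
(Stage 2) and assert nothing about Kim 2025.

References: R. Sakamoto, JTNB 36 (2024) §2 (H.1)–(H.3), (H.SD) (p. 921) [Sakamoto2024]; B. Mazur,
K. Rubin, Mem. AMS 799 (2004) §3.5; J. H. Silverman, *AEC* Prop. III.8.1 [SilvermanAEC2009];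
K. Kato, Astérisque 295 (2004) (12.5.2), Thm. 13.4 (3) [Kato2004Asterisque].
-/

noncomputable section

open scoped Classical

open WeierstrassCurve Field Literature.NumberTheory.EllipticCurves
  Literature.NumberTheory.EllipticCurves.Rank1Residual

namespace Summit.BirchSwinnertonDyer.Rank1Residual.GaloisImage

variable (W : WeierstrassCurve ℚ) [W.IsElliptic] (p : ℕ) [hp : Fact p.Prime]

/-- **(T) ⟹ (H.1) ∧ (H.2)_{every level} ∧ (H.SD) for `(E[p^m], ℤ/p^m)`.** From `p`-adic tower
surjectivity `∀ n, ρ̄_{E,p^n}` onto: (H.1) `E[p]` is an irreducible `Γ_ℚ`-module; (H.2) one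
`σ ∈ Γ_ℚ` fixing every `p`-power root of unity with `E[p^m]/(σ − 1)E[p^m] ≃+ ℤ/p^m` for all `m`;
(H.SD) a bilinear alternating non-degenerate `Γ_ℚ`-equivariant pairing `E[p] × E[p] → μ_p(ℚ̄)`
(Weil), i.e. `E[p] ≅ E[p]^∨(1)`. Sakamoto 2024 §2 / Mazur–Rubin §3.5 hypotheses for the N11 instance,
in tree vocabulary; (H.3) is the Sah-lemma files' business (module docstring).
[cite: Sakamoto2024, §2 (H.1), (H.2), (H.SD) (p. 921)] [cite: SilvermanAEC2009, Prop. III.8.1] -/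
theorem sakamotoHypotheses_of_towerSurj (htower : ∀ n : ℕ, W.HasSurjectiveModNGaloisRep (p ^ n : ℕ)) :
    W.HasIrreducibleModPGaloisRep p ∧
    (∃ σ : absoluteGaloisGroup ℚ,
      (∀ (n : ℕ) (t : AlgebraicClosure ℚ), t ^ p ^ n = 1 → σ • t = t) ∧
      ∀ m : ℕ, Nonempty ((geomTorsion W ((p ^ m : ℕ) : ℤ) ⧸
        ((Multiplicative.toAdd (galoisRepTorsion W ((p ^ m : ℕ) : ℤ) σ)).toAddMonoidHom -
          AddMonoidHom.id (geomTorsion W ((p ^ m : ℕ) : ℤ))).range) ≃+ ZMod (p ^ m))) ∧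
    (∃ e : geomTorsion W p → geomTorsion W p → AlgebraicClosure ℚ,
      (∀ S T, e S T ^ p = 1) ∧
      (∀ S₁ S₂ T, e (S₁ + S₂) T = e S₁ T * e S₂ T) ∧
      (∀ S T₁ T₂, e S (T₁ + T₂) = e S T₁ * e S T₂) ∧
      (∀ T, e T T = 1) ∧
      (∀ T, (∀ S, e S T = 1) → T = 0) ∧
      ∀ (σ : absoluteGaloisGroup ℚ) (S T : geomTorsion W p), σ • e S T = e (σ • S) (σ • T)) := by
  have hpP : p.Prime := hp.out
  haveI : NeZero (p : ℚ) := ⟨Nat.cast_ne_zero.mpr hpP.ne_zero⟩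
  refine ⟨?_, exists_torsion_quotient_equiv_zmod_of_towerSurj W p htower, ?_⟩
  · have h1 := htower 1
    rw [pow_one] at h1
    exact hasIrreducibleModPGaloisRep_of_hasSurjectiveModNGaloisRep W p h1
  · exact exists_weilPairing_holds W p hpP.two_le (Nat.cast_ne_zero.mpr hpP.ne_zero)

/-- **The N11 instance at `p = 3`**: tower surjectivity at `3` (`⟺ surj(9) ⟺ Kato2004.ImageContainsSL2 W 3
⟺ surj(3) ∧ (im)`, files `Kato2004/Condition1252`, `GaloisImage/ExoticThreeAdicImage`) gives
Sakamoto's (H.1), (H.2) at every level `3^m`, and (H.SD) for `E[3]`.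
[cite: Sakamoto2024, §2 (H.1), (H.2), (H.SD) (p. 921)] [cite: SilvermanAEC2009, Prop. III.8.1] -/
theorem sakamotoHypotheses_three_of_towerSurj (htower : ∀ n : ℕ, W.HasSurjectiveModNGaloisRep (3 ^ n : ℕ)) :
    W.HasIrreducibleModPGaloisRep 3 ∧
    (∃ σ : absoluteGaloisGroup ℚ,
      (∀ (n : ℕ) (t : AlgebraicClosure ℚ), t ^ 3 ^ n = 1 → σ • t = t) ∧
      ∀ m : ℕ, Nonempty ((geomTorsion W ((3 ^ m : ℕ) : ℤ) ⧸
        ((Multiplicative.toAdd (galoisRepTorsion W ((3 ^ m : ℕ) : ℤ) σ)).toAddMonoidHom -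
          AddMonoidHom.id (geomTorsion W ((3 ^ m : ℕ) : ℤ))).range) ≃+ ZMod (3 ^ m))) ∧
    (∃ e : geomTorsion W 3 → geomTorsion W 3 → AlgebraicClosure ℚ,
      (∀ S T, e S T ^ 3 = 1) ∧
      (∀ S₁ S₂ T, e (S₁ + S₂) T = e S₁ T * e S₂ T) ∧
      (∀ S T₁ T₂, e S (T₁ + T₂) = e S T₁ * e S T₂) ∧
      (∀ T, e T T = 1) ∧
      (∀ T, (∀ S, e S T = 1) → T = 0) ∧
      ∀ (σ : absoluteGaloisGroup ℚ) (S T : geomTorsion W 3), σ • e S T = e (σ • S) (σ • T)) := by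
  haveI : Fact (Nat.Prime 3) := ⟨Nat.prime_three⟩
  exact sakamotoHypotheses_of_towerSurj W 3 htower

/-- **…and from surj(9) alone** (`forall_hasSurjectiveModNGaloisRep_three_pow_of_nine`): the census
bit of record for (T). [cite: Sakamoto2024, §2 (H.1), (H.2), (H.SD) (p. 921); Rem. 9.1 (p. 938)] -/
theorem sakamotoHypotheses_three_of_surj_nine (h9 : W.HasSurjectiveModNGaloisRep 9) :
    W.HasIrreducibleModPGaloisRep 3 ∧
    (∃ σ : absoluteGaloisGroup ℚ,
      (∀ (n : ℕ) (t : AlgebraicClosure ℚ), t ^ 3 ^ n = 1 → σ • t = t) ∧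
      ∀ m : ℕ, Nonempty ((geomTorsion W ((3 ^ m : ℕ) : ℤ) ⧸
        ((Multiplicative.toAdd (galoisRepTorsion W ((3 ^ m : ℕ) : ℤ) σ)).toAddMonoidHom -
          AddMonoidHom.id (geomTorsion W ((3 ^ m : ℕ) : ℤ))).range) ≃+ ZMod (3 ^ m))) ∧
    (∃ e : geomTorsion W 3 → geomTorsion W 3 → AlgebraicClosure ℚ,
      (∀ S T, e S T ^ 3 = 1) ∧
      (∀ S₁ S₂ T, e (S₁ + S₂) T = e S₁ T * e S₂ T) ∧
      (∀ S T₁ T₂, e S (T₁ + T₂) = e S T₁ * e S T₂) ∧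
      (∀ T, e T T = 1) ∧
      (∀ T, (∀ S, e S T = 1) → T = 0) ∧
      ∀ (σ : absoluteGaloisGroup ℚ) (S T : geomTorsion W 3), σ • e S T = e (σ • S) (σ • T)) :=
  sakamotoHypotheses_three_of_towerSurj W (W.forall_hasSurjectiveModNGaloisRep_three_pow_of_nine h9)

end Summit.BirchSwinnertonDyer.Rank1Residual.GaloisImage

end
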